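import Summits.CriticalPhenomena.PercolationContinuityZ3.Theorems.PercExchangeRateTransportModelFacts
import Literature.Probability.Percolation.CriticalContinuityProofs
import Literature.Probability.Percolation.BernoulliPercolationProofs
import HarnessLib

/-!
# Route `PercExchangeRateTransport`, line `isotropic_locus_continuity` (crux `SupercritExchangeUniformity`,
# stmt-CriticalPhenomena-16061): the on-path step MODULO THE FLOOR, placed low in the import DAG

For the route's label-coupled anisotropic bond family on `ℤ²×ℤ` (`x`/`y`-bonds open iff `U_e ≤ p`,
`z`-bonds iff `U_e ≤ t`; `θ(p,t) = μ{0 percolates}`, critical curve `p_c(t) = sInf ({p ∈ [0,1] | θ(p,t) > 0} ∪ {1})`),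
this module proves

* `locusContinuity_of_curve_continuousOn`: IF `p_c` is continuous on `(0,1)` (first atom of the floor
  `CriticalCurveRegular`, taken as a HYPOTHESIS — the floor's proof file is not imported) and
  `θ_{ℤ³}(p_c(ℤ³)) = 0` (the sub-problem statement `PercolationContinuityZ3` in its unfolded form
  `theta (zdGraph 3) 0 (criticalProbI 3) = 0`), THEN the critical density `t ↦ θ(p_c(t), t)` is continuous
  within `(0,1)` at every `t₀ ∈ {p_c(ℤ³)}` — the second conjunct of the definiens of the line's rung
  `IsoLocus.IsotropicLocusContinuity`.

It imports only `…Theorems.PercExchangeRateTransportModelFacts` (clauses (1),(3),(4),(6),(7),(9) of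
`modelFacts_proof`: `Θ_n` continuous, monotone in `p` and `t`, nonnegative, `θ = ⨅ Θ_n`, diagonal = `θ_{ℤ³}`)
and the tree facts `0 < p_c(ℤ³) < 1` (`Grimmett1999_criticalProb_pos_lt_one_holds`), `θ_{ℤ³} = 0` below and
`> 0` above `p_c`.

WHY THIS PLACEMENT.  The on-path lemma `PercolationContinuityZ3 → IsotropicLocusContinuity` is landed in
`…Theorems.PercExchangeRateTransportIsotropicLocusContinuityOnPath` (p181126), a module ABOVE both
`…CriticalCurveRegular` and `…ModelFacts`; the crux workfile
`Cruxes/SupercritExchangeUniformity/Lines/isotropic_locus_continuity.lean` imports exactly those two, so the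
tribunal's default probe of that file cannot see p181126 (`forward.on_path` reads `false` unless `--imports`
is passed; onpath-landed.jsonl gens 7–16).  With the step modulo the floor HERE (below `…CriticalCurveRegular`),
that file can append the kernel-visible forms proved from `CriticalCurveRegular_proof`, and the line file sees
them by construction.

Proof (Grimmett 1999 §1.4, §3.3 bookkeeping; the real-variable part is percolation-free and stated for an
abstract family first): `curve_fixes_isotropic_point` — below `p₃` the curve lies on or above the diagonal
(`θ(p,t) ≤ θ(t,t) = θ_{ℤ³}(t) = 0` for `p < t < p₃`), above `p₃` it lies on or below the level `p₃`
(`θ(q,t) ≥ θ(q,q) > 0` for `p₃ < q < t`), so continuity of `p_c` at `p₃` pins `p_c(p₃) = p₃`;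
`locus_usc_of_curve_fixed` — `J = ⨅_n Θ_n ∘ (p_c, id) ≤ Θ_{n₀} ∘ (p_c, id)`, continuous at `p₃`;
`locus_continuousWithinAt_of_diag_zero` — `θ_{ℤ³}(p₃) = 0` gives `J(p₃) = 0 ≤ J`, so upper semicontinuity
is continuity.  The tactic blocks are those of p181126 (originally the line author's
`Lines/isotropic_locus_continuity_onpath.lean`, planner-fwd2-rung-CriticalPhenomena-01), re-cut into three
lemmas with separate conclusions.

prover-fwd2-land-1-g17-0 (on-path lander, gen 17), 2026-08-19.
-/

noncomputable section

open MeasureTheory Filter Topology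

namespace Summit.CriticalPhenomena.PercolationContinuityZ3.Theorems.IsoLocusOnPathCore

/-! ### Real-variable core (percolation-free)

Data: `Θ n p t` (finite-volume densities), `θ = ⨅ n Θ n`, threshold curve
`pc t = sInf ({p ∈ [0,1] | 0 < θ p t} ∪ {1})`, diagonal `θ p p = th3 p`, isotropic threshold `p₃ ∈ (0,1)`
with `th3 = 0` below and `th3 > 0` above `p₃`. -/

section Core

variable {Θ : ℕ → ℝ → ℝ → ℝ} {θ : ℝ → ℝ → ℝ} {pc : ℝ → ℝ} {th3 : unitInterval → ℝ} {p₃ : ℝ}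

/-- The critical curve passes through the isotropic point: `pc p₃ = p₃`, for `θ = ⨅ Θ_n` monotone in both
parameters (`Θ_n ≥ 0`), `pc` the threshold curve of `θ`, continuous on `(0,1)`, and the diagonal `θ p p = th3 p`
vanishing below `p₃ ∈ (0,1)` and positive above it. -/
theorem curve_fixes_isotropic_point
    (hinf : ∀ p t, θ p t = ⨅ n, Θ n p t)
    (hpc : ∀ t, pc t = sInf ({p : ℝ | 0 ≤ p ∧ p ≤ 1 ∧ 0 < θ p t} ∪ {1}))
    (hmp : ∀ n t, Monotone (fun p => Θ n p t))
    (hmt : ∀ n p, Monotone (fun t => Θ n p t))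
    (hnn : ∀ n p t, 0 ≤ Θ n p t)
    (hdiag : ∀ p : unitInterval, θ p p = th3 p)
    (hpcc : ContinuousOn pc (Set.Ioo 0 1))
    (h3l : 0 < p₃) (h3u : p₃ < 1)
    (h3zero : ∀ p : unitInterval, (p : ℝ) < p₃ → th3 p = 0)
    (h3pos : ∀ p : unitInterval, p₃ < (p : ℝ) → 0 < th3 p) :
    pc p₃ = p₃ := by
  -- a small chooser of margins
  have hpick : ∀ a b c : ℝ, 0 < a → 0 < b → 0 < c →
      ∃ s, 0 < s ∧ s < a ∧ s < b ∧ s ≤ c / 2 := fun a b c ha hb hc => by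
    refine ⟨min a (min b c) / 2, ?_, ?_, ?_, ?_⟩
    · have : 0 < min a (min b c) := lt_min ha (lt_min hb hc); linarith
    · have : min a (min b c) ≤ a := min_le_left _ _; linarith
    · have : min a (min b c) ≤ b := (min_le_right _ _).trans (min_le_left _ _); linarith
    · have : min a (min b c) ≤ c := (min_le_right _ _).trans (min_le_right _ _); linarith
  -- monotonicity of θ = inf_n Θ_n in each parameter
  have hbdd : ∀ p t, BddBelow (Set.range fun n => Θ n p t) := fun p t =>
    ⟨0, by rintro _ ⟨n, rfl⟩; exact hnn n p t⟩
  have hθ_mp : ∀ t p q, p ≤ q → θ p t ≤ θ q t := fun t p q hpq => by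
    rw [hinf, hinf]; exact ciInf_mono (hbdd p t) fun n => hmp n t hpq
  have hθ_mt : ∀ p s t, s ≤ t → θ p s ≤ θ p t := fun p s t hst => by
    rw [hinf, hinf]; exact ciInf_mono (hbdd p s) fun n => hmt n p hst
  -- the set whose infimum is pc t
  have hS_ne : ∀ t, ({p : ℝ | 0 ≤ p ∧ p ≤ 1 ∧ 0 < θ p t} ∪ {1}).Nonempty := fun t =>
    ⟨1, Or.inr rfl⟩
  have hS_bdd : ∀ t, BddBelow ({p : ℝ | 0 ≤ p ∧ p ≤ 1 ∧ 0 < θ p t} ∪ {1}) := fun t =>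
    ⟨0, by
      rintro p (⟨hp, -⟩ | hp)
      · exact hp
      · rw [Set.mem_singleton_iff] at hp; rw [hp]; exact zero_le_one⟩
  have hpc_le : ∀ t q, 0 ≤ q → q ≤ 1 → 0 < θ q t → pc t ≤ q := fun t q h0 h1 hpos => by
    rw [hpc]; exact csInf_le (hS_bdd t) (Or.inl ⟨h0, h1, hpos⟩)
  have hle_pc : ∀ t c, c ≤ 1 → (∀ p, 0 ≤ p → p < c → θ p t ≤ 0) → c ≤ pc t :=
      fun t c hc1 hzero => by
    rw [hpc]
    refine le_csInf (hS_ne t) ?_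
    rintro p (⟨hp0, -, hpos⟩ | hp)
    · by_contra hlt
      exact absurd (hzero p hp0 (not_le.mp hlt)) (not_le.mpr hpos)
    · rw [Set.mem_singleton_iff] at hp; rw [hp]; exact hc1
  -- (A) below the isotropic critical point the curve lies above the diagonal
  have hA : ∀ t, 0 < t → t < p₃ → t ≤ pc t := fun t ht0 ht3 => by
    have ht1 : t ≤ 1 := (ht3.trans h3u).le
    refine hle_pc t t ht1 fun p hp0 hpt => ?_
    have e : θ t t = th3 ⟨t, ht0.le, ht1⟩ := hdiag ⟨t, ht0.le, ht1⟩
    have hz : th3 ⟨t, ht0.le, ht1⟩ = 0 := h3zero ⟨t, ht0.le, ht1⟩ ht3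
    calc θ p t ≤ θ t t := hθ_mp t p t hpt.le
      _ = 0 := by rw [e, hz]
  -- (B) above it the curve lies below the level p₃
  have hB : ∀ t, p₃ < t → t < 1 → pc t ≤ p₃ := fun t ht3 ht1 => by
    by_contra hcon'
    have hcon := not_le.mp hcon'
    obtain ⟨q, hq3, hqpc, hqt⟩ : ∃ q, p₃ < q ∧ q < pc t ∧ q < t :=
      ⟨min ((p₃ + pc t) / 2) ((p₃ + t) / 2), lt_min (by linarith) (by linarith),
        (min_le_left _ _).trans_lt (by linarith), (min_le_right _ _).trans_lt (by linarith)⟩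
    have hq0 : 0 ≤ q := (h3l.trans hq3).le
    have hq1 : q ≤ 1 := (hqt.trans ht1).le
    have hpos : 0 < θ q t := by
      have e : θ q q = th3 ⟨q, hq0, hq1⟩ := hdiag ⟨q, hq0, hq1⟩
      have hp : 0 < th3 ⟨q, hq0, hq1⟩ := h3pos ⟨q, hq0, hq1⟩ hq3
      calc (0 : ℝ) < θ q q := by rw [e]; exact hp
        _ ≤ θ q t := hθ_mt q q t hqt.le
    exact absurd (hpc_le t q hq0 hq1 hpos) (not_le.mpr hqpc)
  -- (C) continuity of the curve at p₃ pins the isotropic point onto the curve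
  have hcw : ContinuousWithinAt pc (Set.Ioo 0 1) p₃ := hpcc p₃ ⟨h3l, h3u⟩
  rw [Metric.continuousWithinAt_iff] at hcw
  apply le_antisymm
  · by_contra hcon'
    have hcon := not_le.mp hcon'
    obtain ⟨δ, hδ, hδ'⟩ := hcw ((pc p₃ - p₃) / 2) (by linarith)
    obtain ⟨s, hs0, hsδ, hs1, -⟩ := hpick δ (1 - p₃) 1 hδ (by linarith) one_pos
    have hmem : p₃ + s ∈ Set.Ioo (0 : ℝ) 1 := ⟨by linarith, by linarith⟩
    have hdist : dist (p₃ + s) p₃ < δ := by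
      rw [Real.dist_eq, show p₃ + s - p₃ = s by ring, abs_of_pos hs0]; exact hsδ
    have h := hδ' hmem hdist
    rw [Real.dist_eq] at h
    have hBt := hB (p₃ + s) (by linarith) (by linarith)
    have h' := (abs_sub_lt_iff.mp h).2
    linarith
  · by_contra hcon'
    have hcon := not_le.mp hcon'
    obtain ⟨δ, hδ, hδ'⟩ := hcw ((p₃ - pc p₃) / 2) (by linarith)
    obtain ⟨s, hs0, hsδ, hs3, hsε⟩ := hpick δ p₃ (p₃ - pc p₃) hδ h3l (by linarith)
    have hmem : p₃ - s ∈ Set.Ioo (0 : ℝ) 1 := ⟨by linarith, by linarith⟩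
    have hdist : dist (p₃ - s) p₃ < δ := by
      rw [Real.dist_eq, show p₃ - s - p₃ = -s by ring, abs_neg, abs_of_pos hs0]; exact hsδ
    have h := hδ' hmem hdist
    rw [Real.dist_eq] at h
    have hAt := hA (p₃ - s) (by linarith) (by linarith)
    have h' := (abs_sub_lt_iff.mp h).1
    linarith

/-- Upper semicontinuity of the critical density `t ↦ θ (pc t) t` at `p₃` within `(0,1)`, given that the
curve passes through the isotropic point (`pc p₃ = p₃`): `θ = ⨅ Θ_n ≤ Θ_{n₀}` with `Θ_{n₀}` continuous and
`pc` continuous at `p₃`. -/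
theorem locus_usc_of_curve_fixed
    (hinf : ∀ p t, θ p t = ⨅ n, Θ n p t)
    (hcont : ∀ n, Continuous (fun x : ℝ × ℝ => Θ n x.1 x.2))
    (hnn : ∀ n p t, 0 ≤ Θ n p t)
    (hpcc : ContinuousOn pc (Set.Ioo 0 1))
    (h3l : 0 < p₃) (h3u : p₃ < 1) (hC : pc p₃ = p₃) :
    ∀ ε, 0 < ε → ∃ δ, 0 < δ ∧ ∀ t ∈ Set.Ioo (0 : ℝ) 1, |t - p₃| < δ →
      θ (pc t) t < θ (pc p₃) p₃ + ε := by
  have hbdd : ∀ p t, BddBelow (Set.range fun n => Θ n p t) := fun p t =>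
    ⟨0, by rintro _ ⟨n, rfl⟩; exact hnn n p t⟩
  have hθ_le : ∀ n p t, θ p t ≤ Θ n p t := fun n p t => by
    rw [hinf]; exact ciInf_le (hbdd p t) n
  intro ε hε
  -- pick n₀ with Θ_{n₀}(p₃,p₃) < J(p₃) + ε
  have hlt : (⨅ n, Θ n p₃ p₃) < θ (pc p₃) p₃ + ε := by
    rw [hC, ← hinf]; exact lt_add_of_pos_right _ hε
  obtain ⟨n₀, hn₀⟩ := exists_lt_of_ciInf_lt hlt
  have hopen : IsOpen {x : ℝ × ℝ | Θ n₀ x.1 x.2 < θ (pc p₃) p₃ + ε} :=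
    isOpen_lt (hcont n₀) continuous_const
  obtain ⟨r, hr, hball⟩ := Metric.isOpen_iff.mp hopen (p₃, p₃) hn₀
  have hcw : ContinuousWithinAt pc (Set.Ioo 0 1) p₃ := hpcc p₃ ⟨h3l, h3u⟩
  rw [Metric.continuousWithinAt_iff] at hcw
  obtain ⟨δ₁, hδ₁, hδ₁'⟩ := hcw r hr
  refine ⟨min δ₁ r, lt_min hδ₁ hr, fun t ht hdist => ?_⟩
  have hd1 : dist t p₃ < δ₁ := by
    rw [Real.dist_eq]; exact lt_of_lt_of_le hdist (min_le_left _ _)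
  have hd2 : dist t p₃ < r := by
    rw [Real.dist_eq]; exact lt_of_lt_of_le hdist (min_le_right _ _)
  have hpcd : dist (pc t) p₃ < r := by
    have h := hδ₁' ht hd1
    rwa [hC] at h
  have hΘ : Θ n₀ (pc t) t < θ (pc p₃) p₃ + ε := by
    have hmem : ((pc t, t) : ℝ × ℝ) ∈ Metric.ball ((p₃, p₃) : ℝ × ℝ) r := by
      rw [Metric.mem_ball, Prod.dist_eq]; exact max_lt hpcd hd2
    exact hball hmem
  exact (hθ_le n₀ _ _).trans_lt hΘ

/-- Continuity of the critical density `t ↦ θ (pc t) t` at `p₃` within `(0,1)` when moreover `th3 p₃ = 0`: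
then `θ (pc p₃) p₃ = θ p₃ p₃ = 0 ≤ θ`, so upper semicontinuity (`locus_usc_of_curve_fixed` at the fixed
point `curve_fixes_isotropic_point`) is continuity. -/
theorem locus_continuousWithinAt_of_diag_zero (hp₃ : p₃ ∈ unitInterval)
    (hinf : ∀ p t, θ p t = ⨅ n, Θ n p t)
    (hpc : ∀ t, pc t = sInf ({p : ℝ | 0 ≤ p ∧ p ≤ 1 ∧ 0 < θ p t} ∪ {1}))
    (hcont : ∀ n, Continuous (fun x : ℝ × ℝ => Θ n x.1 x.2))
    (hmp : ∀ n t, Monotone (fun p => Θ n p t))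
    (hmt : ∀ n p, Monotone (fun t => Θ n p t))
    (hnn : ∀ n p t, 0 ≤ Θ n p t)
    (hdiag : ∀ p : unitInterval, θ p p = th3 p)
    (hpcc : ContinuousOn pc (Set.Ioo 0 1))
    (h3l : 0 < p₃) (h3u : p₃ < 1)
    (h3zero : ∀ p : unitInterval, (p : ℝ) < p₃ → th3 p = 0)
    (h3pos : ∀ p : unitInterval, p₃ < (p : ℝ) → 0 < th3 p)
    (hS : th3 ⟨p₃, hp₃⟩ = 0) :
    ContinuousWithinAt (fun t => θ (pc t) t) (Set.Ioo 0 1) p₃ := by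
  have hC : pc p₃ = p₃ :=
    curve_fixes_isotropic_point hinf hpc hmp hmt hnn hdiag hpcc h3l h3u h3zero h3pos
  have husc := locus_usc_of_curve_fixed hinf hcont hnn hpcc h3l h3u hC
  have hθ_nn : ∀ p t, 0 ≤ θ p t := fun p t => by
    rw [hinf]; exact le_ciInf fun n => hnn n p t
  have hJ0 : θ (pc p₃) p₃ = 0 := by
    have e : θ p₃ p₃ = th3 ⟨p₃, hp₃⟩ := hdiag ⟨p₃, hp₃⟩
    rw [hC, e, hS]
  rw [Metric.continuousWithinAt_iff]
  intro ε hε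
  obtain ⟨δ, hδ, hδ'⟩ := husc ε hε
  refine ⟨δ, hδ, ?_⟩
  intro t ht hdist
  rw [Real.dist_eq] at hdist
  have h := hδ' t ht hdist
  show dist (θ (pc t) t) (θ (pc p₃) p₃) < ε
  rw [hJ0, Real.dist_eq, sub_zero, abs_of_nonneg (hθ_nn _ _)]
  rw [hJ0, zero_add] at h
  exact h

end Core

/-! ### Instantiation at the route's family, modulo the floor -/

open Literature.Probability.Percolation Literature.Probability.LatticeModels

/-- **On-path step modulo the floor.**  For the route's label-coupled anisotropic family on `ℤ²×ℤ`
(the verbatim `let`-objects `μ, vert, cfg, θ, pc` of `Theses.PercExchangeRateTransport`): if the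
critical curve `pc` is continuous on `(0,1)` (first atom of the floor `CriticalCurveRegular`) and
`θ_{ℤ³}(p_c) = 0` (the sub-problem statement `PercolationContinuityZ3`, unfolded:
`theta (zdGraph 3) 0 (criticalProbI 3) = 0`), then `t ↦ θ (pc t) t` is continuous within `(0,1)` at every
`t₀ ∈ {p_c(ℤ³)}` — the second conjunct of the definiens of `IsoLocus.IsotropicLocusContinuity`.
From `locus_continuousWithinAt_of_diag_zero`, `ModelFacts.modelFacts_proof` (clauses (1),(3),(4),(6),(7),(9))
and the tree facts `0 < p_c(ℤ³) < 1`, `θ_{ℤ³} = 0` below and `> 0` above `p_c`. -/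
theorem locusContinuity_of_curve_continuousOn :
    let μ := labelMeasure (Site 3)
    let vert : Sym2 (Site 3) → Prop := fun e => ∃ x : Site 3, e = s(x, x + Pi.single (2 : Fin 3) 1)
    let cfg : ℝ → ℝ → (Sym2 (Site 3) → ℝ) → Set (Sym2 (Site 3)) :=
      fun p t U => {e | e ∈ (zdGraph 3).edgeSet ∧ ((vert e ∧ U e ≤ t) ∨ (¬ vert e ∧ U e ≤ p))}
    let θ : ℝ → ℝ → ℝ := fun p t => μ.real {U | cfg p t U ∈ percolatesAt (0 : Site 3)}
    let pc : ℝ → ℝ := fun t => sInf ({p : ℝ | 0 ≤ p ∧ p ≤ 1 ∧ 0 < θ p t} ∪ {1})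
    ContinuousOn pc (Set.Ioo 0 1) → theta (zdGraph 3) (0 : Site 3) (criticalProbI 3) = 0 →
      ∀ t₀ ∈ ({criticalProb (zdGraph 3) (0 : Site 3)} : Set ℝ), t₀ ∈ Set.Ioo (0 : ℝ) 1 →
        ContinuousWithinAt (fun t => θ (pc t) t) (Set.Ioo 0 1) t₀ := by
  intro μ vert cfg θ pc hcc hS
  obtain ⟨h1, -, h3, h4, -, h6, h7, -, h9, -⟩ :=
    Summit.CriticalPhenomena.PercolationContinuityZ3.Theorems.ModelFacts.modelFacts_proof
  have h3b := Grimmett1999_criticalProb_pos_lt_one_holds 3 (by norm_num)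
  intro t₀ ht₀ _
  rw [Set.mem_singleton_iff] at ht₀
  subst ht₀
  exact locus_continuousWithinAt_of_diag_zero (th3 := theta (zdGraph 3) 0)
    (criticalProb_mem_Icc (zdGraph 3) 0) h7 (fun _ => rfl) h1 h3 h4 (fun n p t => (h6 n p t).1) h9 hcc
    h3b.1 h3b.2 (fun p hp => theta_eq_zero_of_lt_criticalProb_holds _ _ p hp)
    (fun p hp => theta_pos_of_criticalProb_lt_holds _ _ p hp) hS

end Summit.CriticalPhenomena.PercolationContinuityZ3.Theorems.IsoLocusOnPathCore

end
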